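import Summits.CriticalPhenomena.PercolationContinuityZ3.Theorems.Transplant.PlanarSkeletonFrmFromDefs
import Summits.CriticalPhenomena.PercolationContinuityZ3.Theorems.Transplant.SkelKitResiduesOF
import Summits.CriticalPhenomena.PercolationContinuityZ3.Theorems.Transplant.SkelFrmFrom1Normalise
import Summits.CriticalPhenomena.PercolationContinuityZ3.Theorems.Transplant.SkelFrm1Normalise
import Summits.CriticalPhenomena.PercolationContinuityZ3.Theorems.Transplant.KNLevelsStepVForced
import Summits.CriticalPhenomena.PercolationContinuityZ3.Theorems.Transplant.SkelNeg1ClosureL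
import HarnessLib
import Summits.CriticalPhenomena.PercolationContinuityZ3.Theorems.Transplant.SkelFrm1ClosureL
/-!
# U-WAVE PORT (RULING D-U, lead g21 2026-08-26; WAVE-U-MANIFEST v3.0 row «SkelFrm1ClosureL» ↦ «SkelFrmFrom1ClosureL») of the tree module
# `Transplant/SkelFrm1ClosureL` onto the carrier `PlanarSkeletonFrmFrom` (frames only, cylinders connected from width `ℓ₀` on)

ORIGINAL TITLE: N2 (the frames-only node `SamePDropOfSkeletonFrm₁`, OPEN), WAVE 0 (c2) file 3: THE RESIDUE-LEVEL CLOSURE OF RECORD —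

builds on p205010 (kernel theorem, internal audit signed; external expert review pending) — nothing in this file uses p205010; NOTHING is claimed about the
OPEN node U `SamePDropOfSkeletonFrmFrom₁` (nor U_s / the end state).  Lane `prim-bschramm`, seat `prim-bschramm-p3` gen 26; helper file
(`--supports stmt-CriticalPhenomena-4575 --as helper`).  PORT RULES r1–r4 of RULING D-U: declaration order and proof texts are those of the original,
byte-identical except (i) the carrier token `PlanarSkeletonFrm ↦ PlanarSkeletonFrmFrom` (binders, `namespace`/`end` lines, qualified names of twinned
declarations), (ii) carrier-FREE declarations of the original (φ-level `Skelφ…` blocks and namespace-only arithmetic residents) are NOT re-declared —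
this file imports the original and `export`s the twin-free residents (POLICY T / treatment (m1)); residents whose statement mentions a twinned
constant are copied, (iii) every carrier-binding declaration keeps its explicit binder `(Φ : PlanarSkeletonFrmFrom G)` in its own signature (r2).  Docstrings and citations are the original's.
-/

noncomputable section

open MeasureTheory ProbabilityTheory
open scoped ENNReal Classical

namespace Summit.CriticalPhenomena.PercolationContinuityZ3.Theorems.Transplant

open Literature.Probability.Percolation Literature.Probability.LatticeModels SimpleGraph KNCells KNLevels
open Literature.Barriers.CriticalPhenomena (HasExponentialGrowth)
open GadgetSystem (tgt)

namespace PlanarSkeletonFrmFrom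

/-- **THE N2 PARTIAL CLOSURE FROM THE THREE RESIDUES, QUADRANT-NORMALISED, (S0) KITS, ROOT FORWARD + LAW-CARRYING, CORRIDOR SOURCE-SEPARATED AND LENGTH-BUDGETED, ONE KIT ACCURACY**
(twin of `PlanarSkeletonNeg.samePDropOfSkeletonNeg₁_of_residuesNOWL`, SkelNeg1ClosureL :47–:77, over `PlanarSkeletonFrm`/`OutNS`/`indexNQ`/`KitsAtF`; endgame by `Skelφ.kitAtRunO_of_oblRHNMWF_src` (SkelKitResiduesOF) and `KSchA.theta_pos_of_kitAtRunO`).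
Constants: `δ := 2⁻³⁷`; `C` from `chain_edge_from_source_F_KN`; `δ₂ := min (δ/(2(C+1))) 1`-shape; `K₀` from `(1−δ₂)^K₀ < 2⁻³⁵`; root table `δt n := δ/((n+1)(C+1)+1)`, flat on `[0, Lf K₀]` at
`δ0 := min (min δm cap) capC`. [cite: KozmaNitzan2024, §4 Theorem 6 (pp. 25–31); §1 p. 2 (approach 1)] -/
theorem samePDropOfSkeletonFrmFrom₁_of_residuesNQL (Lf : ℕ → ℕ)
    (hres : ∀ (K₀ : ℕ) (δ δ₂ : ℝ) (δr : ℕ → ℝ), 0 < δ → δ ≤ 1 → 0 < δ₂ → δ₂ ≤ 1 → (∀ n, 0 < δr n ∧ δr n ≤ 1) →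
      (∀ n, n ≤ Lf K₀ → δr n = δr 0) →
      ∀ {V : Type} [DecidableEq V] [Countable V] (G : SimpleGraph V) [G.LocallyFinite] (Φ : PlanarSkeletonFrmFrom G),
        ¬ HasExponentialGrowth G → ∀ t ∈ Φ.types, Φ.types = {t} → ∀ p : unitInterval, 0 < (p : ℝ) → (p : ℝ) < 1 →
          (∀ᵐ ω ∂bondPercolation G p, numInfiniteClusters ω ≤ 1) → ∀ hC : Φ.CylSubcritical p, 0 < theta G t p →
          (∀ n, n ≤ Lf K₀ → ∀ (q' : unitInterval), (q' : ℝ) < 1 →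
            ∀ (c : V) (Rπ : ℕ) (Wg : Sym2 V → unitInterval) (s : Fin (n + 1) → KNLevels.TStep (Skel.winGraph G c Rπ))
              (T' : Fin (n + 1) → Finset V) (η : ℝ),
              (∀ i : Fin (n + 1), (s i).L.o = (s 0).L.o) →
              (∀ i : Fin n, T' (Fin.castSucc i) ⊆ (s i.succ).L.X 0) →
              (∀ i : Fin (n + 1), T' i ⊆ (s i).T) →
              (∀ i : Fin (n + 1), (s i).KitsAtF Wg q' Φ.Δ (δr 0)) →
              η ≤ δr 0 / 2 →
              (∀ i : Fin (n + 1), (prodBernoulli Wg).real (⋃ t ∈ (s i).T \ T' i, openConn (s 0).L.o t) ≤ η) →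
              1 - δr 0 < (prodBernoulli Wg).real (s 0).L.reachB →
                1 - δ₂ ^ 2 < (prodBernoulli Wg).real (⋃ t ∈ T' (Fin.last n), openConn (s 0).L.o t)) →
            ∃ (δI : ℝ) (m₀ : ℕ), 0 < δI ∧ δI < 1 ∧
              ∀ O : Skelφ.StepI.OutNS V, O.FactsNS (G := G) Φ.frame hC m₀ t →
                ∃ (Sz : Finset ℕ) (SMn : Finset (ℕ × ℕ)), (∀ M ∈ Sz, O.D.M₀ ≤ M) ∧ (∀ q ∈ SMn, O.D.M₀ ≤ q.1 ∧ O.D.n₁ q.1 ≤ q.2) ∧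
                  ∀ q : unitInterval, (p : ℝ) / 2 ≤ q → (q : ℝ) ≤ p →
                    (∀ i ∈ Skelφ.StepI.indexNQ {t} Sz SMn (Skelφ.StepI.sgQ O.qd O.qdT O.ori),
                      1 - δI < (bondPercolation G q).real (Skelφ.StepI.eventO G Φ.φ O.D.toDataN O.DT.toDataN O.ori i)) →
                    Φ.CylSubcritical q →
                      ∃ (Γ : CellGeom V ℕ) (FD : FaceData V ℕ) (LD : LevelData V ℕ),
                        Γ.root = t ∧ K₀ ≤ Γ.K ∧
                        RunGeom G Γ ∧ AnchGeom Γ ∧ SepGeom₂ G Γ ∧ ExitGeom G Γ ∧ StepsGeom Γ FD ∧ LevelGeom G Γ FD LD ∧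
                        Skel.RootOblTWF G (⟨Γ, q, δ⟩ : KSchA V ℕ) Φ.Δ δr ∧
                        Skelφ.FaceOblRMOF G (⟨Γ, q, δ⟩ : KSchA V ℕ) FD Φ.Δ δ₂ ∧
                        ∃ nmax : ℕ, nmax ≤ Lf K₀ ∧ Skel.ReachOblRHNOF G nmax (⟨Γ, q, δ⟩ : KSchA V ℕ) FD Φ.Δ (δr 0)) :
    SamePDropOfSkeletonFrmFrom₁ := by
  refine samePDropOfSkeletonFrmFrom₁_of_stepI_outNS fun {V} _ _ G _ Φ hg t ht h1 p hp0 hp1 hU hC hθ => ?_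
  have hε' : (0 : ℝ) < (1 / 2) ^ 35 := by positivity
  have hΔ : ∀ v, G.degree v ≤ Φ.Δ := Φ.degree_le
  -- (1) the scheme threshold `δc := 2⁻³⁷`
  obtain ⟨δ, hδdef⟩ : ∃ δ : ℝ, δ = (1 / 2) ^ 37 := ⟨_, rfl⟩
  have hδ0 : 0 < δ := by rw [hδdef]; positivity
  have hδ1 : δ ≤ 1 := by rw [hδdef]; norm_num
  -- (2) the ONE additive (S0) chain estimate (constant `C`): faces (n = 0), root chains (table), corridor (flat)
  obtain ⟨C, hC0, hchA⟩ := KNLevels.chain_edge_from_source_F_KN (V := V) (Δ := Φ.Δ)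
  -- the face accuracy `δ₂` with `δ₂ (C + 2) ≤ δ / 2`
  have hC2 : (0 : ℝ) < 2 * (C + 2) := by positivity
  obtain ⟨δ₂, hδ₂def⟩ : ∃ δ₂ : ℝ, δ₂ = δ / (2 * (C + 2)) := ⟨_, rfl⟩
  have hδ₂0 : 0 < δ₂ := by rw [hδ₂def]; exact div_pos hδ0 hC2
  have h2 : 2 * (C + 2) * δ₂ = δ := by rw [hδ₂def]; exact mul_div_cancel₀ δ (ne_of_gt hC2)
  have hCδ₂ : 0 ≤ C * δ₂ := mul_nonneg hC0 hδ₂0.le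
  have h2' : 2 * (C * δ₂) + 4 * δ₂ = δ := by rw [← h2]; ring
  have hδ₂1 : δ₂ ≤ 1 := by linarith
  have hδ₂key : δ₂ + (C * δ₂ + 0) ≤ δ / 2 := by linarith
  obtain ⟨K₀, hK₀⟩ := exists_pow_lt_of_lt_one hε' (show 1 - δ₂ < 1 by linarith)
  -- (3) the one-step face fact from the chain estimate at `n = 0`
  have hstep : ∀ (q : unitInterval), (q : ℝ) < 1 → ∀ (G' : SimpleGraph V) [G'.LocallyFinite], G' ≤ G →
      ∀ (Wg : Sym2 V → unitInterval) (s : KNLevels.TStep G'), s.KitsAtF Wg q Φ.Δ δ₂ →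
        1 - δ₂ < (prodBernoulli Wg).real s.L.reachB → 1 - δ / 2 < (prodBernoulli Wg).real (⋃ t ∈ s.T, openConn s.L.o t) := by
    intro q hq1 G' _ hG' Wg s hk hsrc
    have hGd : ∀ x, G'.degree x ≤ Φ.Δ := SkelConc.degree_le_of_subgraph G hΔ _ hG'
    have hmain := hchA 0 hδ₂0 hδ₂1 δ₂ q hq1 G' hGd Wg (fun _ => s) (fun _ => s.T) 0 (fun _ => rfl) (fun i => Fin.elim0 i) (fun _ => subset_rfl)
      (fun _ => hk) (fun _ => by simp) hsrc
    have e : (⋃ t ∈ (fun _ : Fin 1 => s.T) (Fin.last 0), openConn ((fun _ : Fin 1 => s) 0).L.o t) = ⋃ t ∈ s.T, openConn s.L.o t := rfl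
    rw [e] at hmain
    refine lt_of_le_of_lt ?_ hmain
    push_cast; linarith
  -- (4) the root chain accuracies `δt n := δ / ((n+1)(C+1) + 1)` and the root chain property at them
  set δt : ℕ → ℝ := fun n => δ / (((n + 1 : ℕ) : ℝ) * (C + 1) + 1) with hδtdef
  have hδtden : ∀ n : ℕ, (0 : ℝ) < ((n + 1 : ℕ) : ℝ) * (C + 1) + 1 := fun n => by positivity
  have hδt0 : ∀ n, 0 < δt n := fun n => div_pos hδ0 (hδtden n)
  have hδt1 : ∀ n, δt n ≤ 1 := fun n => by
    have : δt n ≤ δ := by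
      rw [hδtdef]; exact div_le_self hδ0.le (by nlinarith [hδtden n])
    exact this.trans hδ1
  -- (5) the FLAT root table on `[0, Lf K₀]` with the two caps
  set LF : ℕ := Lf K₀ with hLF
  have hmin : ∀ L : ℕ, ∃ δm : ℝ, 0 < δm ∧ δm ≤ 1 ∧ ∀ k, k ≤ L → δm ≤ δt k := by
    intro L
    induction L with
    | zero => exact ⟨δt 0, hδt0 0, hδt1 0, fun k hk => by rw [Nat.le_zero.1 hk]⟩
    | succ m ih =>
      obtain ⟨δm, hm0, hm1, hm⟩ := ih
      refine ⟨min δm (δt (m + 1)), lt_min hm0 (hδt0 _), (min_le_left _ _).trans hm1, fun k hk => ?_⟩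
      rcases Nat.lt_or_ge k (m + 1) with hlt | hge
      · exact (min_le_left _ _).trans (hm k (by omega))
      · obtain rfl : k = m + 1 := le_antisymm hk hge
        exact min_le_right _ _
  obtain ⟨δm, hδm0, hδm1, hδm⟩ := hmin LF
  set cap : ℝ := δ₂ ^ 2 / (2 * (((LF + 1 : ℕ) : ℝ) * (C + 1) + 1)) with hcapdef
  have hcapden : (0 : ℝ) < 2 * (((LF + 1 : ℕ) : ℝ) * (C + 1) + 1) := by positivity
  have hcap0 : 0 < cap := div_pos (by positivity) hcapden
  set capC : ℝ := (1 / 2 : ℝ) ^ 37 / (((LF + 1 : ℕ) : ℝ) * (C + 1)) with hcapCdef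
  have hcapCden : (0 : ℝ) < ((LF + 1 : ℕ) : ℝ) * (C + 1) := by positivity
  have hcapC0 : 0 < capC := div_pos (by positivity) hcapCden
  set δ0 : ℝ := min (min δm cap) capC with hδ0def
  have hδ00 : 0 < δ0 := lt_min (lt_min hδm0 hcap0) hcapC0
  have hδ01 : δ0 ≤ 1 := ((min_le_left _ _).trans (min_le_left _ _)).trans hδm1
  have hδ0t : ∀ k, k ≤ LF → δ0 ≤ δt k := fun k hk => ((min_le_left _ _).trans (min_le_left _ _)).trans (hδm k hk)
  have hδ0cap : δ0 ≤ cap := (min_le_left _ _).trans (min_le_right _ _)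
  have hδ0capC : δ0 ≤ capC := min_le_right _ _
  set δr : ℕ → ℝ := fun n => if n ≤ LF then δ0 else δt n with hδrdef
  have hδr_le : ∀ n, δr n ≤ δt n := fun n => by
    simp only [hδrdef]; split_ifs with h
    · exact hδ0t n h
    · exact le_rfl
  have hδr0 : ∀ n, 0 < δr n := fun n => by simp only [hδrdef]; split_ifs <;> [exact hδ00; exact hδt0 n]
  have hδr1 : ∀ n, δr n ≤ 1 := fun n => (hδr_le n).trans (hδt1 n)
  have hflat : ∀ n, n ≤ LF → δr n = δr 0 := fun n hn => by simp only [hδrdef, if_pos hn, if_pos (Nat.zero_le _)]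
  have hδr00 : δr 0 = δ0 := by simp only [hδrdef, if_pos (Nat.zero_le _)]
  -- the root chain property at the table: kits at `δr n ≤ δt n`, excess `η ≤ δr n / 2`, source `1 − δr n` ⟹ `1 − δ`
  have hchainr : ∀ (n : ℕ) (q : unitInterval), (q : ℝ) < 1 → ∀ (G' : SimpleGraph V) [G'.LocallyFinite], G' ≤ G →
      ∀ (Wt : Sym2 V → unitInterval) (s : Fin (n + 1) → TStep G') (T' : Fin (n + 1) → Finset V) (η : ℝ),
      (∀ i : Fin (n + 1), (s i).L.o = (s 0).L.o) →
      (∀ i : Fin n, T' (Fin.castSucc i) ⊆ (s i.succ).L.X 0) →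
      (∀ i : Fin (n + 1), T' i ⊆ (s i).T) →
      (∀ i : Fin (n + 1), (s i).KitsAtF Wt q Φ.Δ (δr n)) →
      η ≤ δr n / 2 →
      (∀ i : Fin (n + 1), (prodBernoulli Wt).real (⋃ t ∈ (s i).T \ T' i, openConn (s 0).L.o t) ≤ η) →
      1 - δr n < (prodBernoulli Wt).real (s 0).L.reachB →
        1 - δ < (prodBernoulli Wt).real (⋃ t ∈ T' (Fin.last n), openConn (s 0).L.o t) := by
    intro n q hq1 G' _ hG' Wt s T' η ho hlink hsub hkits hη hexc hsrc
    have hGd : ∀ x, G'.degree x ≤ Φ.Δ := SkelConc.degree_le_of_subgraph G hΔ _ hG'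
    have hmain := hchA n (hδr0 n) (hδr1 n) (δr n) q hq1 G' hGd Wt s T' η ho hlink hsub hkits hexc hsrc
    have hη1 : 0 ≤ η := measureReal_nonneg.trans (hexc 0)
    have hkey : δr n + ((n + 1 : ℕ) : ℝ) * (C * δr n + η) ≤ δ := by
      have h1 : C * δr n + η ≤ (C + 1) * δr n := by nlinarith
      have h2 : ((n + 1 : ℕ) : ℝ) * (C * δr n + η) ≤ ((n + 1 : ℕ) : ℝ) * ((C + 1) * δr n) :=
        mul_le_mul_of_nonneg_left h1 (by positivity)
      have h3 : δt n * (((n + 1 : ℕ) : ℝ) * (C + 1) + 1) = δ := by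
        simp only [hδtdef]; field_simp
      have h4 : δr n * (((n + 1 : ℕ) : ℝ) * (C + 1) + 1) ≤ δ := by
        rw [← h3]; exact mul_le_mul_of_nonneg_right (hδr_le n) (hδtden n).le
      nlinarith
    linarith
  -- the face inner-chain fact at `δr 0 = δ0`
  have hchainF : ∀ n, n ≤ Lf K₀ → ∀ (q' : unitInterval), (q' : ℝ) < 1 →
      ∀ (c : V) (Rπ : ℕ) (Wg : Sym2 V → unitInterval) (s : Fin (n + 1) → KNLevels.TStep (Skel.winGraph G c Rπ))
        (T' : Fin (n + 1) → Finset V) (η : ℝ),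
        (∀ i : Fin (n + 1), (s i).L.o = (s 0).L.o) →
        (∀ i : Fin n, T' (Fin.castSucc i) ⊆ (s i.succ).L.X 0) →
        (∀ i : Fin (n + 1), T' i ⊆ (s i).T) →
        (∀ i : Fin (n + 1), (s i).KitsAtF Wg q' Φ.Δ (δr 0)) →
        η ≤ δr 0 / 2 →
        (∀ i : Fin (n + 1), (prodBernoulli Wg).real (⋃ t ∈ (s i).T \ T' i, openConn (s 0).L.o t) ≤ η) →
        1 - δr 0 < (prodBernoulli Wg).real (s 0).L.reachB →
          1 - δ₂ ^ 2 < (prodBernoulli Wg).real (⋃ t ∈ T' (Fin.last n), openConn (s 0).L.o t) := by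
    intro n hn q' hq' c Rπ Wg s T' η ho hlink hsub hkits hη hexc hsrc
    rw [hδr00] at hkits hη hsrc
    have hGc : ∀ x, (Skel.winGraph G c Rπ).degree x ≤ Φ.Δ := SkelConc.degree_le_of_subgraph G hΔ _ (Skel.winGraph_le G c Rπ)
    have hmain := hchA n hδ00 hδ01 δ0 q' hq' (Skel.winGraph G c Rπ) hGc Wg s T' η ho hlink hsub hkits hexc hsrc
    have hη1 : 0 ≤ η := measureReal_nonneg.trans (hexc 0)
    have hn1 : ((n + 1 : ℕ) : ℝ) ≤ (LF + 1 : ℕ) := by rw [hLF]; exact_mod_cast Nat.succ_le_succ hn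
    have hkey : δ0 + ((n + 1 : ℕ) : ℝ) * (C * δ0 + η) ≤ δ₂ ^ 2 / 2 := by
      have h1 : C * δ0 + η ≤ (C + 1) * δ0 := by linarith
      have h2 : ((n + 1 : ℕ) : ℝ) * (C * δ0 + η) ≤ ((LF + 1 : ℕ) : ℝ) * ((C + 1) * δ0) :=
        mul_le_mul hn1 h1 (add_nonneg (mul_nonneg hC0 hδ00.le) hη1) (by positivity)
      have h3 : δ0 * (2 * (((LF + 1 : ℕ) : ℝ) * (C + 1) + 1)) ≤ δ₂ ^ 2 := (le_div_iff₀ hcapden).1 hδ0cap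
      linarith
    have hδ₂sq : (0 : ℝ) < δ₂ ^ 2 := by positivity
    linarith
  -- (6) the residues at these constants
  obtain ⟨δI, m₀, hδI, hδI1, hS⟩ := hres K₀ δ δ₂ δr hδ0 hδ1 hδ₂0 hδ₂1 (fun n => ⟨hδr0 n, hδr1 n⟩)
    hflat G Φ hg t ht h1 p hp0 hp1 hU hC hθ hchainF
  refine ⟨δI, m₀, hδI, hδI1, fun O hfacts => ?_⟩
  obtain ⟨Sz, SMn, hSz, hSMn, hB⟩ := hS O hfacts
  refine ⟨Sz, SMn, hSz, hSMn, fun q hq1 hq2 hcq hCq => ?_⟩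
  have hq1' : (q : ℝ) < 1 := lt_of_le_of_lt hq2 hp1
  have hq0 : 0 < (q : ℝ) := by linarith
  obtain ⟨Γ, FD, LD, hroot, hK, hrun, hanch, hsep, hexit, hsteps, hlev, hrootO, hfaceO, nmax, hnmax, hreachO⟩ := hB q hq1 hq2 hcq hCq
  -- (7) the endgame: KitAtRunO at `(δ₂, 2⁻³⁵)`, then θ > 0
  have hKε : 4 * ((1 - δ₂) ^ Γ.K + (1 / 2 : ℝ) ^ 35) ≤ (1 / 2) ^ 32 := by
    have hKpow : (1 - δ₂) ^ Γ.K ≤ (1 / 2 : ℝ) ^ 35 := (pow_le_pow_of_le_one (by linarith) (by linarith) hK).trans hK₀.le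
    have h32 : (4 : ℝ) * ((1 / 2) ^ 35 + (1 / 2) ^ 35) = (1 / 2) ^ 32 := by norm_num
    linarith
  have hkit : KSchA.KitAtRunO G (⟨Γ, q, δ⟩ : KSchA V ℕ) FD δ₂ ((1 / 2) ^ 35) := by
    refine Skelφ.kitAtRunO_of_oblRHNMWF_src (S := ⟨Γ, q, δ⟩)
      (fun c Rπ Wg s hk hsrc => hstep q hq1' (Skel.winGraph G c Rπ) (Skel.winGraph_le G c Rπ) Wg s hk hsrc) ?_
      (fun n c Rπ => hchainr n q hq1' (Skel.winGraph G c Rπ) (Skel.winGraph_le G c Rπ)) hrootO hfaceO hreachO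
    -- the corridor chains: source at `δc = 2⁻³⁷`, kits at the FLAT root accuracy `δr 0 = δ0`, `n ≤ nmax ≤ Lf K₀` rounds ⟹ `2⁻³⁵`
    intro n hn Ω Wg s T' η ho hlink hsub hkits hη hexc hsrc
    rw [hδr00] at hkits hη
    have hGΩ : ∀ x, (Skel.winGraphIn G Ω).degree x ≤ Φ.Δ := SkelConc.degree_le_of_subgraph G hΔ _ (Skel.winGraphIn_le G Ω)
    have hη1 : 0 ≤ η := measureReal_nonneg.trans (hexc 0)
    have hmain := hchA n hδ00 hδ01 δ q hq1' (Skel.winGraphIn G Ω) hGΩ Wg s T' η ho hlink hsub hkits hexc hsrc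
    have hn1 : ((n + 1 : ℕ) : ℝ) ≤ (LF + 1 : ℕ) := by rw [hLF]; exact_mod_cast Nat.succ_le_succ (hn.trans hnmax)
    have hkey : ((n + 1 : ℕ) : ℝ) * (C * δ0 + η) ≤ (1 / 2 : ℝ) ^ 37 := by
      have h1 : C * δ0 + η ≤ (C + 1) * δ0 := by linarith
      have h2 : ((n + 1 : ℕ) : ℝ) * (C * δ0 + η) ≤ ((LF + 1 : ℕ) : ℝ) * ((C + 1) * δ0) :=
        mul_le_mul hn1 h1 (add_nonneg (mul_nonneg hC0 hδ00.le) hη1) (by positivity)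
      have h3 : δ0 * (((LF + 1 : ℕ) : ℝ) * (C + 1)) ≤ (1 / 2 : ℝ) ^ 37 := (le_div_iff₀ hcapCden).1 hδ0capC
      linarith
    have h35 : (1 / 2 : ℝ) ^ 37 + (1 / 2) ^ 37 ≤ (1 / 2) ^ 35 := by norm_num
    have hb : δ + ((n + 1 : ℕ) : ℝ) * (C * δ0 + η) ≤ (1 / 2 : ℝ) ^ 35 := by
      have hδeq : δ = (1 / 2 : ℝ) ^ 37 := hδdef
      rw [hδeq]; linarith
    exact lt_of_le_of_lt (by linarith) hmain
  have hθq := KSchA.theta_pos_of_kitAtRunO (S := ⟨Γ, q, δ⟩) hrun hanch hsep hexit hsteps hlev hδ1 le_rfl hε'.le hδ₂1 hKε hq0 hkit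
  rw [hroot] at hθq
  exact hθq

end PlanarSkeletonFrmFrom

end Summit.CriticalPhenomena.PercolationContinuityZ3.Theorems.Transplant

end
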